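import Summits.BirchSwinnertonDyer.BirchSwinnertonDyer.Theorems.EisensteinPrimesBSDpOnCellCImprimitiveCountSplitOfBr
import HarnessLib

/-!
# Orientation at a SPLIT multiplicative Eisenstein prime, MIRRORED: `θsub` unramified at `v̄` forces `θquot` RAMIFIED at `v̄`
# (cell `bsd-eis`, LEAD cruxlead-19034 g0; companion of x2-p2 g10's `…SplitMultOrientation` (p675389), whose two theorems give the other
# direction «`θquot` unramified ⟹ `θsub` ramified»; consumed by `…KellerYinLemma511OfBrAnom` to supply the ANOMALOUS clause of [BR𝟙-anom] at
# either orientation of the Teichmüller pair; `--supports stmt-BirchSwinnertonDyer-19034`)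

HONEST FRAMING: two kernel theorems about a residual pair of `E_K[p]` at a split multiplicative odd `p` with `p = v v̄` split in the imaginary
quadratic `K` (pure Galois-module bookkeeping on the tree's `localData_of_split`: the local pair at `v̄` is `(ω, 𝟙)` or `(𝟙, ω)` and the mod-`p`
cyclotomic character is ramified at `v̄` since `e(v̄|p) = 1 < p − 1`); 0 defs, 0 named facts, 0 sorry; nothing about any `L`-function, Selmer group,
main conjecture or BSD is asserted; 0 cells / labels / tiers move. Proof = x2-p2 g10's with the two cases of `localData_of_split` exchanged.

References: [GreenbergVatsal2000] §2 pp. 14–15 (local types at an Eisenstein prime); [SerreAbelianLadic1968] Ch. I §2.1; cell p675389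
(`SplitMultOrientation`), p667xxx (`ResidualDevissageSplitLocalData.localData_of_split`), p629299 (`ResidualPairStableLine`).
-/

set_option autoImplicit false
set_option linter.dupNamespace false -- the summit namespace `…BirchSwinnertonDyer.BirchSwinnertonDyer.Theorems` (Sub = Summit, D-0017) trips it

noncomputable section

open scoped Classical MatrixGroups ModularForm

open CongruenceSubgroup WeierstrassCurve NumberField IsDedekindDomain Field PowerSeries
  Literature.NumberTheory.EllipticCurves Literature.NumberTheory.EllipticCurves.GreenbergSelmer
  Literature.NumberTheory.EllipticCurves.ModularForms Literature.NumberTheory.QuadraticFields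
  Literature.NumberTheory.EllipticCurves.Rank1Residual
  Literature.NumberTheory.EllipticCurves.Rank1Residual.Typed
  Literature.NumberTheory.EllipticCurves.KrizLi2019
  Literature.NumberTheory.EllipticCurves.GreenbergVatsal2000
  Literature.NumberTheory.EllipticCurves.Wuthrich2014
  Literature.NumberTheory.EllipticCurves.SteinWuthrich2013
  Literature.NumberTheory.EllipticCurves.Castella2018Exceptional
  Literature.NumberTheory.EllipticCurves.Castella2018
  Literature.NumberTheory.GaloisRepresentations Literature.NumberTheory.GaloisCohomology
  Literature.NumberTheory.Automorphic
  Literature.NumberTheory.EllipticCurves.CastellaGrossiLeeSkinner2022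
  Literature.NumberTheory.IwasawaTheory Literature.NumberTheory.IwasawaTheory.Greenberg2016
  Literature.NumberTheory.IwasawaTheory.Greenberg2006
  Summit.BirchSwinnertonDyer.Rank1Residual.X11b.AcSelmer
  Summit.BirchSwinnertonDyer.Rank1Residual.X11b.Halves
  Summit.BirchSwinnertonDyer.Rank1Residual.X11b
  Summit.BirchSwinnertonDyer.Rank1Residual Summit.BirchSwinnertonDyer.Rank1Residual.X1
  Summit.BirchSwinnertonDyer.Rank1Residual.X1.KellerYinMuLambdaSplit
  Summit.BirchSwinnertonDyer.Rank1Residual.X2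
  Summit.BirchSwinnertonDyer.BirchSwinnertonDyer.Theorems
  Summit.BirchSwinnertonDyer.BirchSwinnertonDyer.Theorems.EisensteinPrimesMuLambda
open Literature.NumberTheory.EllipticCurves.KellerYin2024

namespace Summit.BirchSwinnertonDyer.BirchSwinnertonDyer.Theorems.SplitMultOrientationMirror

section Orientation

variable {p : ℕ} [hp : Fact p.Prime]

/-- **Mirror of x2-p2 g10's `SplitMultOrientation.exists_mem_inertia_unitChar_ne_one_of_split_of_quot_unramified`.** At a SPLIT multiplicative
odd `p` with `p = v v̄` split in the imaginary quadratic `K`: if `θsub` is trivial on the inertia group at `v̄` then some inertia element at `v̄`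
moves `θquot` — the local pair at `v̄` is then `(𝟙, ω)` and `ω` is ramified at `v̄` (`e(v̄|p) = 1 < p − 1`). Same proof as the original with the
two cases of `ResidualDevissageSplitLocalData.localData_of_split` exchanged. [cite: GreenbergVatsal2000, §2 pp. 14–15 (the local types `(ω, 𝟙)`/`(𝟙, ω)`)]
[cite: SerreAbelianLadic1968, Ch. I §2.1] -/
theorem exists_mem_inertia_unitChar_ne_one_of_split_of_sub_unramified (W : WeierstrassCurve ℚ) [W.IsElliptic] [W.IsGloballyMinimal]
    (K : Type) [Field K] [NumberField K] (hp2 : p ≠ 2)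
    (hsplitred : W.HasSplitMultiplicativeReductionAtPrime p) (hK : IsImaginaryQuadratic K)
    (hsplit : ((Ideal.span {(p : ℤ)}).primesOver (𝓞 K)).ncard = 2)
    {v vbar : HeightOneSpectrum (𝓞 K)} (hpv : ((p : ℕ) : 𝓞 K) ∈ v.asIdeal) (hvbar : ((p : ℕ) : 𝓞 K) ∈ vbar.asIdeal)
    (hne : vbar ≠ v)
    {θsub θquot : FramedGaloisRep K (padicCoeffIntegers (∅ : Set (PadicAlgCl p))) 1}
    (hpair : IsResidualPairOver (W.baseChange K) p θsub θquot)
    (hsub : ∀ τ ∈ inertia vbar, unitChar θsub τ = 1) :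
    ∃ τ ∈ inertia vbar, unitChar θquot τ ≠ 1 := by
  have hpr : p.Prime := hp.out
  haveI hEK : (W.baseChange K).IsElliptic := inferInstanceAs (W.map (algebraMap ℚ K)).IsElliptic
  obtain ⟨Φ, hSub, -, ⟨j₁, hj₁, hj₁inj, -⟩, ⟨j₃, hj₃, hj₃inj, -⟩⟩ :=
    ResidualPairStableLine.exists_stableLine_of_isResidualPairOver (W.baseChange K) hpair
  obtain ⟨hQuot, hcases⟩ :=
    ResidualDevissageSplitLocalData.localData_of_split (p := p) W K vbar hsplitred hK hsplit hvbar Φ hSub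
  -- an inertia element with non-trivial cyclotomic character
  obtain ⟨τ, hτ, hχ⟩ := SplitMultOrientation.exists_mem_inertia_modNCyclotomicCharacter_ne_one_of_split (K := K) hp2 hK hpv hvbar hne
  have hτD : τ ∈ decomp vbar := GreenbergSelmer.inertia_le_decomp vbar hτ
  haveI : Finite Φ.Sub := Nat.finite_of_card_ne_zero (by rw [hSub]; exact hpr.ne_zero)
  haveI : Finite Φ.Quot := Nat.finite_of_card_ne_zero (by rw [hQuot]; exact hpr.ne_zero)
  rcases hcases with ⟨-, hcycQ⟩ | ⟨hcyc, -⟩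
  · -- (𝟙, ω): `τ` acts on `E_K[p]/Φ` by `χ̄_p(τ) ≠ 1`, so `θquot(τ) ≠ 1`
    have hnt : Nontrivial Φ.Quot := by
      rw [← Finite.one_lt_card_iff_nontrivial, hQuot]
      exact hpr.one_lt
    obtain ⟨y₀, hy₀⟩ := exists_ne (0 : Φ.Quot)
    refine ⟨τ, hτ, fun h1 ↦ ?_⟩
    have hfix : τ • y₀ = y₀ := by
      apply hj₃inj
      rw [hj₃]
      exact CharLocalInertiaFrobenius.smul_eq_self_of_apply_eq_one θquot
        ((GreenbergFullAtSelmer.unitChar_eq_one_iff θquot τ).mp h1) (j₃ y₀)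
    have h := hcycQ τ hτD y₀
    rw [hfix] at h
    exact hχ (SplitMultOrientation.eq_one_of_val_smul_eq hQuot hy₀ h.symm)
  · -- (ω, 𝟙): `τ` would move the line `Φ ↪ (F/𝒪)(θsub)`, but `θsub(τ) = 1` fixes it — contradiction
    exfalso
    have hnt : Nontrivial Φ.Sub := by
      rw [← Finite.one_lt_card_iff_nontrivial, hSub]
      exact hpr.one_lt
    obtain ⟨x₀, hx₀⟩ := exists_ne (0 : Φ.Sub)
    have hfix : τ • x₀ = x₀ := by
      apply hj₁inj
      rw [hj₁]
      exact CharLocalInertiaFrobenius.smul_eq_self_of_apply_eq_one θsub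
        ((GreenbergFullAtSelmer.unitChar_eq_one_iff θsub τ).mp (hsub τ hτ)) (j₁ x₀)
    have h := hcyc τ hτD x₀
    rw [hfix] at h
    exact hχ (SplitMultOrientation.eq_one_of_val_smul_eq hSub hx₀ h.symm)

/-- **The same from `θsub.IsUnramifiedAt v̄`** (the tree's `FramedGaloisRep.IsUnramifiedAt`). [cite: GreenbergVatsal2000, §2 pp. 14–15]
[cite: SerreAbelianLadic1968, Ch. I §2.1] -/
theorem exists_mem_inertia_unitChar_ne_one_of_split_of_sub_isUnramifiedAt (W : WeierstrassCurve ℚ) [W.IsElliptic] [W.IsGloballyMinimal]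
    (K : Type) [Field K] [NumberField K] (hp2 : p ≠ 2)
    (hsplitred : W.HasSplitMultiplicativeReductionAtPrime p) (hK : IsImaginaryQuadratic K)
    (hsplit : ((Ideal.span {(p : ℤ)}).primesOver (𝓞 K)).ncard = 2)
    {v vbar : HeightOneSpectrum (𝓞 K)} (hpv : ((p : ℕ) : 𝓞 K) ∈ v.asIdeal) (hvbar : ((p : ℕ) : 𝓞 K) ∈ vbar.asIdeal)
    (hne : vbar ≠ v)
    {θsub θquot : FramedGaloisRep K (padicCoeffIntegers (∅ : Set (PadicAlgCl p))) 1}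
    (hpair : IsResidualPairOver (W.baseChange K) p θsub θquot)
    (hsub : θsub.IsUnramifiedAt vbar) :
    ∃ τ ∈ inertia vbar, unitChar θquot τ ≠ 1 := by
  refine exists_mem_inertia_unitChar_ne_one_of_split_of_sub_unramified W K hp2 hsplitred hK hsplit hpv hvbar hne hpair
    fun τ hτ ↦ ?_
  have e : inertia vbar = (adicCompletionPrime K vbar).inertia (absoluteGaloisGroup K) :=
    (inertia_adicCompletionPrime_eq_map_absInertia K vbar).symm
  rw [e] at hτ
  exact CharLocalInertiaFrobenius.unitChar_eq_one_of_apply_eq_one θsub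
    (hsub _ (adicCompletionPrime_mem_primesAbove K vbar) τ hτ)

end Orientation

end Summit.BirchSwinnertonDyer.BirchSwinnertonDyer.Theorems.SplitMultOrientationMirror

end
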